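import Literature.AlgebraicGeometry.HodgeTheory.ChernCharacterBetti
import HarnessLib

/-!
# The projective bundle of a vector bundle on a smooth projective complex variety, with its
# tautological quotient (named fact)

Family `hodge`, layer `Literature/AlgebraicGeometry/HodgeTheory`. ONE named fact (a `def … : Prop`,
never asserted); statement only.

THE NAMED FACT `ProjectiveBundleTautologicalQuotient` — ONE STEP of Grothendieck's splitting
construction. For a vector bundle `F` of rank `≤ r + 1` (the tree's `Motives.HasRankLE F (r + 1)`) on a
smooth projective complex variety `X` there are a smooth projective complex variety `P`, a SURJECTIVE
morphism `p : P ⟶ X` and a short exact sequence of `𝒪_P`-modules `0 → K → p^*F → L → 0` with `L` of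
rank `≤ 1` and `K` of rank `≤ r`. In print (Hartshorne II §7, «The projective space bundle `𝐏(ℰ)`
associated to a locally free sheaf `ℰ`»): `π : 𝐏(ℰ) = 𝐏𝐫𝐨𝐣(Sym ℰ) → X`, and «(b) there is a natural
surjective morphism `π^*ℰ → 𝒪(1)`» (Prop. 7.11); its kernel is locally free of rank `rank ℰ - 1`
(Zariski-locally on `X`, `𝐏(ℰ) ≅ X × ℙʳ` and the sequence is the Euler sequence; Fulton B.5.5 /
§3.1: the universal (tautological) exact sequence on `P(E)`); `π` is smooth and projective with
fibres `ℙʳ`, so for `X` smooth projective and geometrically irreducible `𝐏(ℰ)` is a smooth projective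
variety (geometrically irreducible, of dimension `dim X + r`) and `π` is surjective. (For `F = 0` the
statement holds trivially with `P = X`, `K = L = 0`; on the integral `X` a vector bundle has constant
rank, so `HasRankLE F (r + 1)` means rank `r' ≤ r + 1`, and then `K` has rank `r' - 1 ≤ r`.) Recorded
here is exactly this one step, in the tree's vocabulary — `IsSmoothProjective`, Mathlib's
`AlgebraicGeometry.Surjective` and `Scheme.Modules.pullback`, `ShortComplex.ShortExact`,
`Motives.HasRankLE` — and NOT the construction `P = 𝐏(F)`, which the tree does not have (Mathlib has
`Proj` of a graded ring, not the relative `𝐏𝐫𝐨𝐣` of a sheaf of graded algebras).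

WHY. Iterating this step `rank F` times IS the splitting construction (Fulton §3.2: «For one bundle
`E`, `f` is constructed by induction on the rank of `E`. Let `P = P(E)` […] If `E'` is the quotient
bundle […] inductively we construct `q : X' → P` with […] `q^*E'` filtered. Then `f = p q`»): the tree's
named fact `FlagBundleSplitting` (`HodgeTheory/FlagBundleSplitting`: a surjective `g : Y ⟶ X` from a
smooth projective `Y` with `HasFullFlag (g^*F)`) FOLLOWS from `ProjectiveBundleTautologicalQuotient` by
induction on `r` (`HodgeTheory/FlagBundleSplittingOfProjectiveBundle`, using the pull-back stability of
full flags and bounded ranks, `KTheory/PullbackFullFlag`), and with it `SplittingPrincipleBetti` and the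
cycle law `chₖ(F(ℂ)) ∈ algebraicClasses X k` for every vector bundle. So the one construction the tree
still lacks for Grothendieck's *principe de scindage* is `𝐏(ℰ) → X` with `π^*ℰ ↠ 𝒪(1)` — one level,
not the tower.

Nothing here bears on any case of the Hodge conjecture.

## References

* [Hartshorne1977] R. Hartshorne, *Algebraic Geometry* (1977), II §7, «The projective space bundle»,
  Prop. 7.10, Prop. 7.11.
* [Fulton1998] W. Fulton, *Intersection Theory*, 2nd ed. (1998), §3.1, §3.2 (splitting construction),
  Appendix B.5.5.
* [Grothendieck1958] A. Grothendieck, *La théorie des classes de Chern*, Bull. SMF 86 (1958), §2.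
-/

noncomputable section

open CategoryTheory AlgebraicGeometry Literature.AlgebraicGeometry.Motives

namespace Literature.AlgebraicGeometry.HodgeTheory

section HodgeTheory

/-- **The projective bundle of a vector bundle, with its tautological quotient** (named fact; one
step of the splitting construction). For a vector bundle `F` of rank `≤ r + 1` on a smooth projective
complex variety `X` there are a smooth projective complex variety `P`, a SURJECTIVE morphism
`p : P ⟶ X`, and a short exact sequence `0 → K → p^*F → L → 0` of `𝒪_P`-modules with `L` of rank
`≤ 1` and `K` of rank `≤ r` (the middle term identified with `p^*F` by an isomorphism). In print:
`π : 𝐏(ℰ) → X` and «there is a natural surjective morphism `π^*ℰ → 𝒪(1)`» (Hartshorne II Prop. 7.11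
(b)), whose kernel is locally free of rank `rank ℰ - 1` (the tautological exact sequence, Fulton
B.5.5); `𝐏(ℰ)` is smooth and projective over `X` with fibres `ℙʳ`, hence a smooth projective variety,
geometrically irreducible with `X`, and `π` is surjective; for `F = 0` take `P = X`, `K = L = 0`. Only
these consequences are recorded (the tree has no `𝐏(ℰ)` of a locally free sheaf). Iterated on the
rank it yields `FlagBundleSplitting` (`HodgeTheory/FlagBundleSplittingOfProjectiveBundle`).
[cite: Hartshorne1977, II §7 Prop. 7.10 and Prop. 7.11 (b) (the projective space bundle P(E))]
[cite: Fulton1998, §3.2 (splitting construction) and Appendix B.5.5]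
[cite: Grothendieck1958, §2 (principe de scindage)] -/
def ProjectiveBundleTautologicalQuotient : Prop :=
  ∀ (n : ℕ) (X : SchemeOver ℂ), IsSmoothProjective n X → ∀ (F : X.left.Modules) (r : ℕ),
    HasRankLE F (r + 1) →
    ∃ (m : ℕ) (P : SchemeOver ℂ) (p : P ⟶ X), IsSmoothProjective m P ∧ Surjective p.left ∧
      ∃ S : ShortComplex P.left.Modules, S.ShortExact ∧ HasRankLE S.X₁ r ∧ HasRankLE S.X₃ 1 ∧
        Nonempty (S.X₂ ≅ (Scheme.Modules.pullback p.left).obj F)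

end HodgeTheory

end Literature.AlgebraicGeometry.HodgeTheory

end
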